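import Literature.AnabelianGeometry.SemiGraphs.CoveringBranchFrames
import Literature.AnabelianGeometry.SemiGraphs.ApproximatorTransportProofs
import Literature.AnabelianGeometry.SemiGraphs.Commensurability
import Literature.AnabelianGeometry.Anabelioids.FiberFunctorUnique
import Literature.AnabelianGeometry.SemiGraphs.OfProfiniteGroupsRemark261

/-!
# Elevation ascends to finite étale coverings ([SemiAnbd] Def. 2.4 (i)) — (D6)

Mochizuki, *Semi-graphs of anabelioids*, Publ. RIMS **42** (2006) 221–322, Def. 2.4 (i) p. 25
("elevated"), implicit on p. 30 (Cor. 2.7: "every vertex of `ℍ`, `𝕂` is elevated [relative to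
`𝒢`]") [cite: MochizukiSemiAnbd2006, Def. 2.4(i) p.25].  abc-iut cell, layer L3, DISCHARGE-L3 §G
row G30 (D6) (abc-iut-L4-t17, over abc-iut-L6-d5's approximator transport `ApproximatorTransport*`):

`isElevated_of_isFiniteEtaleCoveringOf (φ : Hom 𝒢′ 𝒢) (A) (hφ : φ.IsFiniteEtaleCoveringOf A) (v′)
  (hv : 𝒢.IsElevated (φ v′)) : 𝒢′.IsElevated v′`

— the dictionary fact `covering_isElevated` WITHOUT its connectedness / global / alignment /
quasi-coherence hypotheses (elevation is a statement about a finite group avoiding ALL conjugates of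
the branch groups, insensitive to the twists of finding L4t17-F1).  Proof: given `M`, run `𝒢`'s
elevation at `v = φ(v′)` with `M · d`, `d := [Π_v : ι(Π_{v′})]` (finite, `CoveringBranchFrames`), to
get `ψ : 𝒢 → 𝒢₀`; the approximator of `𝒢′` is the transport `𝒢′ → (φ ≫ ψ).imageAnabelioids`
(abc-iut-L6-d5 `transport_isPi1EpiApproximator`); its vertex constituent embeds into `𝒢₀,w` by
`j := π₁` of the factor `fromImageAnabelioids` (`fromImage_isPi1Mono`), with image
`ψ_v(ι Π_{v′})` of index dividing `d`; `N′ := j⁻¹(N)` has `|N′| = |Im j ∩ N| ≥ M`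
(a private index count) and meets every conjugate of every branch subgroup trivially since `j`
carries branch subgroups into branch subgroups (`comap_inf_conj_branchSubgroup_eq_bot`, from
`map_branchSubgroup_le_aligned`).  Nothing here takes a side on [IUTchIII] Cor. 3.12; typed ≠ discharged.
-/



/-! ## (D6) toolkit: transfer of ELEVATION along a `π₁`-monomorphic morphism (generic part) -/

namespace Literature.AnabelianGeometry

open CategoryTheory CategoryTheory.Functor CategoryTheory.PreGaloisCategory
open scoped Pointwise

/-! ### Group theory -/

section GroupTheory

variable {Γ : Type*} [Group Γ]

/-- **A finite subgroup meets a subgroup of index `≤ d` in at least `|N| / d` elements**: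
`|N| ≤ |H ∩ N| · [Γ : H]` (the map `N/(H ∩ N) ↪ Γ/H`). [folklore] -/
private theorem card_le_card_inf_mul_index (N H : Subgroup Γ) (hH : H.index ≠ 0) :
    Nat.card N ≤ Nat.card ↥(H ⊓ N) * H.index := by
  have h1 : Nat.card ↥(H.subgroupOf N) * H.relIndex N = Nat.card N := Subgroup.card_mul_index _
  have h2 : H.relIndex N ≤ H.index := by
    rw [← Subgroup.relIndex_top_right]
    exact Subgroup.relIndex_le_of_le_right le_top (by rwa [Subgroup.relIndex_top_right])
  have h3 : Nat.card ↥(H.subgroupOf N) = Nat.card ↥(H ⊓ N) := by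
    rw [← Subgroup.inf_subgroupOf_right]
    exact Nat.card_congr (Subgroup.subgroupOfEquivOfLe inf_le_right).toEquiv
  calc Nat.card N = Nat.card ↥(H.subgroupOf N) * H.relIndex N := h1.symm
    _ ≤ Nat.card ↥(H ⊓ N) * H.index := by rw [h3]; exact Nat.mul_le_mul_left _ h2

/-- Hence: if `M · d ≤ |N|` and `[Γ : H] ≤ d` (nonzero), then `M ≤ |H ∩ N|`. [folklore] -/
private theorem le_card_inf_of_mul_le_card (N H : Subgroup Γ) {M d : ℕ} (hH : H.index ≠ 0)
    (hd : H.index ≤ d) (hM : M * d ≤ Nat.card N) : M ≤ Nat.card ↥(H ⊓ N) := by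
  have h := (hM.trans (card_le_card_inf_mul_index N H hH)).trans
    (Nat.mul_le_mul_left _ hd)
  exact Nat.le_of_mul_le_mul_right h (Nat.pos_of_ne_zero (fun h0 => hH (by omega)))

end GroupTheory


namespace SemiGraphs

open Literature.AnabelianGeometry.Anabelioids

universe v₁ u₁ u

namespace SemiGraphOfAnabelioids

variable {𝒢'' 𝒢₀ : SemiGraphOfAnabelioids.{v₁, u₁, u}}

/-- **Killing transfer (the heart of (D6)).** For ANY morphism `η : 𝒢″ → 𝒢₀`, vertex `v″`,
basepoint `F″` of `𝒢″_{v″}` with `j := π₁(η_{v″}^*)` injective: a subgroup `N ⊆ Π₀ := Aut (η_{v″}^* ⋙ F″)`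
meeting every conjugate of every branch subgroup of `𝒢₀` at `η(v″)` trivially pulls back to
`j⁻¹(N) ⊆ Π_{v″}` meeting every conjugate of every branch subgroup of `𝒢″` at `v″` trivially — because
`j` carries branch subgroups INTO branch subgroups (`map_branchSubgroup_le_aligned`).
[cite: MochizukiSemiAnbd2006, Def. 2.4(i) p.25] -/
theorem comap_inf_conj_branchSubgroup_eq_bot (η : Hom 𝒢'' 𝒢₀) (v'' : 𝒢''.graph.Vertex)
    (F'' : 𝒢''.V v'' ⥤ FintypeCat.{v₁}) (hj : Function.Injective (pi1Map (η.φV v'').pullback F''))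
    (N : Subgroup (Aut ((η.φV v'').pullback ⋙ F'')))
    (hN : ∀ (b₀ : 𝒢₀.graph.Branch) (h₀ : 𝒢₀.graph.abuts b₀ = some (η.base.vertexMap v''))
      (Fe₀ : 𝒢₀.E (𝒢₀.graph.edgeOf b₀) ⥤ FintypeCat.{v₁}) [PreGaloisCategory.FiberFunctor Fe₀]
      (α₀ : (𝒢₀.pull b₀ _ h₀).pullback ⋙ Fe₀ ≅ (η.φV v'').pullback ⋙ F'')
      (g : Aut ((η.φV v'').pullback ⋙ F'')),
      N ⊓ ConjAct.toConjAct g • 𝒢₀.branchSubgroup _ b₀ h₀ Fe₀ α₀ = ⊥)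
    (b'' : 𝒢''.graph.Branch) (h'' : 𝒢''.graph.abuts b'' = some v'')
    (Fe'' : 𝒢''.E (𝒢''.graph.edgeOf b'') ⥤ FintypeCat.{v₁})
    [PreGaloisCategory.FiberFunctor ((η.φE (𝒢''.graph.edgeOf b'')
      (𝒢₀.graph.edgeOf (η.base.branchMap b'')) (η.base.edgeOf_branchMap b'').symm).pullback ⋙ Fe'')]
    (α'' : (𝒢''.pull b'' v'' h'').pullback ⋙ Fe'' ≅ F'') (g'' : Aut F'') :
    N.comap (pi1Map (η.φV v'').pullback F'') ⊓
      ConjAct.toConjAct g'' • 𝒢''.branchSubgroup F'' b'' h'' Fe'' α'' = ⊥ := by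
  set j := pi1Map (η.φV v'').pullback F'' with hjdef
  rw [eq_bot_iff]
  rintro x ⟨hxN, hxB⟩
  have hle := map_branchSubgroup_le_aligned η b'' v'' h'' (η.base.branchMap b'') rfl F'' Fe'' α''
  have hjx : j x ∈ ConjAct.toConjAct (j g'') •
      η.alignedBranchSubgroup b'' v'' h'' (η.base.branchMap b'') rfl F'' Fe'' α'' := by
    have : j x ∈ (ConjAct.toConjAct g'' • 𝒢''.branchSubgroup F'' b'' h'' Fe'' α'').map j :=
      ⟨x, hxB, rfl⟩
    rw [map_conjAct_smul] at this
    exact Subgroup.pointwise_smul_le_pointwise_smul_iff.mpr hle this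
  have hbot := hN (η.base.branchMap b'') (η.base.abuts_branchMap b'' v'' h'') _
    (η.alignIso b'' v'' h'' (η.base.branchMap b'') rfl F'' Fe'' α'') (j g'')
  have hmem : j x ∈ N ⊓ ConjAct.toConjAct (j g'') •
      𝒢₀.branchSubgroup _ (η.base.branchMap b'') (η.base.abuts_branchMap b'' v'' h'') _
        (η.alignIso b'' v'' h'' (η.base.branchMap b'') rfl F'' Fe'' α'') :=
    ⟨Subgroup.mem_comap.mp hxN, hjx⟩
  rw [hbot, Subgroup.mem_bot] at hmem
  rw [Subgroup.mem_bot]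
  exact hj (by rw [hmem, map_one])

end SemiGraphOfAnabelioids

end SemiGraphs

end Literature.AnabelianGeometry

/-! ## (D6): elevation ascends to finite étale coverings -/

namespace Literature.AnabelianGeometry.SemiGraphs

open CategoryTheory CategoryTheory.Functor CategoryTheory.PreGaloisCategory
open Literature.AnabelianGeometry.Anabelioids
open scoped Pointwise

universe v₁ u₁ u

namespace SemiGraphOfAnabelioids

variable {𝒢 𝒢' : SemiGraphOfAnabelioids.{v₁, u₁, u}}

/-- **(D6) core: a vertex of a (locally) finite étale covering lying over an ELEVATED vertex is
elevated** ([SemiAnbd] Def. 2.4 (i); implicit on p. 30).  Given `M`, run `𝒢`'s elevation at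
`v = φ(v′)` with `M · d`, `d := [Π_v : ι(Π_{v′})]` (finite étale `φ_{v′}`), to get `ψ : 𝒢 → 𝒢₀`; the
approximator of `𝒢′` is abc-iut-L6-d5's transport `τ : 𝒢′ → (φ ≫ ψ).imageAnabelioids`, whose vertex
constituent embeds into `𝒢₀,w` by `j := π₁` of the factor `η := fromImageAnabelioids` (injective,
`fromImage_isPi1Mono`) with image of index `≤ d` (`= ψ_v(ι Π_{v′})`); `N′ := j⁻¹(N)` has
`|N′| = |N ∩ Im j| ≥ |N| / d ≥ M` and meets every conjugate of every branch subgroup trivially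
because `j` carries branch subgroups into branch subgroups (`comap_inf_conj_branchSubgroup_eq_bot`).
Alignment, connectedness and quasi-coherence are not needed. [cite: MochizukiSemiAnbd2006, Def. 2.4(i) p.25] -/
theorem isElevated_of_isFiniteEtaleCoveringOf (φ : Hom 𝒢' 𝒢) (A : 𝒢.BObj)
    (hφ : φ.IsFiniteEtaleCoveringOf A) (v' : 𝒢'.graph.Vertex)
    (hv : 𝒢.IsElevated (φ.base.vertexMap v')) : 𝒢'.IsElevated v' := by
  intro M hM
  -- the degree `d = [Π_v : ι Π_{v′}]` at a fixed basepoint `F₁` of `𝒢′_{v′}`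
  let F₁ : 𝒢'.V v' ⥤ FintypeCat.{v₁} := GaloisCategory.getFiberFunctor (𝒢'.V v')
  haveI : FiberFunctor ((φ.φV v').pullback ⋙ F₁) := fiberFunctor_comp_of_exact _ _
  obtain ⟨SV, hSV, αV, hαV, ⟨eV⟩⟩ := exists_iso_star_comp_φV φ A hφ v'
  haveI := hSV; haveI := hαV
  set d := (pi1Map (φ.φV v').pullback F₁).range.index with hd
  have hd0 : d ≠ 0 := index_range_pi1Map_ne_zero SV αV eV F₁
  -- `𝒢`'s elevation at `M · d`
  obtain ⟨𝒢₀, ψ, happ, hN⟩ := hv (M * d) (Nat.one_le_iff_ne_zero.mpr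
    (Nat.mul_ne_zero (Nat.one_le_iff_ne_zero.mp hM) hd0))
  have h₀ : 𝒢₀.IsOfBoundedOrder := happ.isApproximator.isOfBoundedOrder
  refine ⟨(φ.comp ψ).imageAnabelioids, (φ.comp ψ).toImageAnabelioids,
    transport_isPi1EpiApproximator φ ψ h₀, ?_⟩
  intro F'₀ hF'₀
  -- `F′₀` is a basepoint of the image anabelioid `I_{(φ ≫ ψ)_{v′}} = 𝒢′₀_{v′}` (re-read the vertex)
  change (φ.comp ψ).imageAnabelioids.V v' ⥤ FintypeCat.{v₁} at F'₀
  change FiberFunctor (C := (φ.comp ψ).imageAnabelioids.V v') F'₀ at hF'₀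
  -- the factor `η : image → 𝒢₀` and `j := π₁(η_{v′})`
  set η := (φ.comp ψ).fromImageAnabelioids with hη
  set j := pi1Map (η.φV v').pullback F'₀ with hjdef
  have hmono := fromImage_isPi1Mono ((φ.comp ψ).φV v')
  have hj : Function.Injective j := @hmono F'₀ hF'₀
  haveI : FiberFunctor (((η.φV v').pullback ⋙ F'₀ :
      𝒢₀.V (ψ.base.vertexMap (φ.base.vertexMap v')) ⥤ FintypeCat.{v₁})) :=
    fiberFunctor_comp_of_exact _ _
  -- `𝒢`'s finite subgroup `N` at the basepoint `η_{v′}^* ⋙ F′₀` of `𝒢₀,w`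
  obtain ⟨N, hNfin, hNcard, hNkill⟩ := hN ((η.φV v').pullback ⋙ F'₀)
  -- bounded order of the image: `Aut F′₀` is finite
  obtain ⟨M₀, _, hbd⟩ := (transport_isPi1EpiApproximator φ ψ h₀).isApproximator.isOfBoundedOrder.exists_bound
  haveI : Finite (Aut F'₀) := (hbd v' F'₀).1
  refine ⟨N.comap j, Finite.of_injective _ (N.comap j).subtype_injective, ?_, ?_⟩
  · -- `M ≤ |j⁻¹(N)| = |Im j ∩ N|`, since `[Π₀ : Im j] ≤ d`
    have hcard : Nat.card ↥(N.comap j) = Nat.card ↥(j.range ⊓ N) := by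
      rw [Nat.card_congr (Subgroup.equivMapOfInjective (N.comap j) j hj).toEquiv,
        Subgroup.map_comap_eq]
    -- the index of `Im j`: move to the basepoint `ι ⋙ F₁`, where `Im j = Im π₁((φ ≫ ψ)_{v′})`
    haveI : FiberFunctor ((imageObj ((φ.comp ψ).φV v').pullback).ι ⋙ F₁) :=
      fiberFunctor_comp_of_exact _ _
    obtain ⟨e⟩ := @nonempty_iso_of_fiberFunctor _ _ _
      ((imageObj ((φ.comp ψ).φV v').pullback).ι ⋙ F₁) F'₀ inferInstance hF'₀
    have hidx1 : j.range.index =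
        (pi1Map (η.φV v').pullback ((imageObj ((φ.comp ψ).φV v').pullback).ι ⋙ F₁)).range.index :=
      (index_range_pi1Map_eq_of_iso (η.φV v').pullback e).symm
    have hrange : (pi1Map (η.φV v').pullback
        ((imageObj ((φ.comp ψ).φV v').pullback).ι ⋙ F₁)).range =
        (pi1Map ((φ.comp ψ).φV v').pullback F₁).range := by
      refine le_antisymm ?_ ?_
      · rintro _ ⟨τ, rfl⟩
        obtain ⟨σ, rfl⟩ := pi1Map_imageIncl_surjective ((φ.comp ψ).φV v') F₁ τ
        exact ⟨σ, rfl⟩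
      · rintro _ ⟨σ, rfl⟩
        exact ⟨pi1Map (imageObj ((φ.comp ψ).φV v').pullback).ι F₁ σ, rfl⟩
    have hrange2 : (pi1Map ((φ.comp ψ).φV v').pullback F₁).range =
        ((pi1Map (φ.φV v').pullback F₁).range).map
          (pi1Map (ψ.φV (φ.base.vertexMap v')).pullback ((φ.φV v').pullback ⋙ F₁)) :=
      range_pi1Map_comp_φV φ ψ v' F₁
    have hsurj : Function.Surjective
        (pi1Map (ψ.φV (φ.base.vertexMap v')).pullback ((φ.φV v').pullback ⋙ F₁)) :=
      happ.isPi1Epi_V _ _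
    have hdvd : j.range.index ∣ d := by
      rw [hidx1, hrange, hrange2, hd]
      exact Subgroup.index_map_dvd _ hsurj
    have hidx0 : j.range.index ≠ 0 := fun h0 => hd0 (Nat.eq_zero_of_zero_dvd (h0 ▸ hdvd))
    exact (le_card_inf_of_mul_le_card N j.range hidx0
      (Nat.le_of_dvd (Nat.pos_of_ne_zero hd0) hdvd) hNcard).trans_eq hcard.symm
  · -- `j⁻¹(N)` meets every conjugate of every branch subgroup trivially
    intro b h Fe hFe α g
    haveI : FiberFunctor ((η.φE _ _ (η.base.edgeOf_branchMap b).symm).pullback ⋙ Fe) :=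
      fiberFunctor_comp_of_exact _ _
    exact comap_inf_conj_branchSubgroup_eq_bot η v' F'₀ hj N hNkill b h Fe α g

end SemiGraphOfAnabelioids

end Literature.AnabelianGeometry.SemiGraphs
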